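import Literature.MathematicalPhysics.QuantumFieldTheory.Balaban1983to89.B3Norm132TwoFamilyMultiplier
import Literature.MathematicalPhysics.QuantumFieldTheory.Balaban1983to89.B3Eq116TwoSidedExpansion

/-!
# Bałaban, *(Higgs)₂,₃ quantum fields in a finite volume III. Renormalization* [B3] — inequality (2.5) p. 424, THE (1.16) ALTERNATIVE, with print's
# SMOOTH localization functions: the GENUINE `‖h(the operator (1.16) with exponents n, n′)h′‖_{1,α}` on a carrier of the decl of record
# `ScaledKernels.Ineq25At`, and `Ineq25At n n′` (BOTH clauses) PROVED FROM THE KERNEL ENTRIES of the operator (1.16) — FILE 5(a) of the (1.16) programme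

statement-level skeleton of published theorems with citation tags; proofs where landed; nothing here is a claim about the Yang–Mills mass gap

T. Bałaban, Commun. Math. Phys. **88** (1983) 411–445 [cite: Balaban1983Higgs3]; part I, Commun. Math. Phys. **85** (1982) 603–626
[cite: Balaban1982Higgs1].  PDF held: `paper:balaban1983-higgs-2-3-quantum-fields-finite-volume` (journal page = PDF page + 410), p. 414 [PDF 4], p. 420
[PDF 10], p. 424 [PDF 14].

CITATION HEADER (lean-in-tree rule).  Cell `lit-balaban` (HOME `run/shared/lean/pub/lit-balaban/`), Phase-2 proof seat **p40** gen 72 (unit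
`lit-balaban-p40`; TAKING line HOME/STATUS.md 2026-08-23T04:01:59Z); SKELETON rows **B3.Eq2.5** (decl of record `B3Sect2StatementsPart2.ScaledKernels.Ineq25At`,
p346302) and **B3.Eq1.16** (fold owner r15); owner item `B3-CLOSURE.md` v1.22 §5 item 11 = the lead's Q7 condition (i) «a member proving the (1.16)
ALTERNATIVE of (2.5) at print's generality»; r14 g19's programme `DESIGN-B3-116-analytic.md` (FILE P `B3Op116Pieces` p347247 = p40 g70; FILE E
`B3Op116ScaleChains` p346964/p347897/p350234, FILE 3(a) `B3Op116SourceForm` p349167, FILE 3(b) `B3Op116KernelRegularTorus` p351073/p351573 = r14 g19;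
FILE 4 = p35; **FILE 5 = p40**, this file being its part (a): the assembly from kernel entries; part (b) = the plug on FILE 3(b)/FILE 4's theorems).
USED BY NAME, never restated: p40 g70's `op116`/`opV` (`B3Eq116TwoSidedExpansion`, p346398); p33 g61's carrier `sect2DeltaSmooth`, `SmoothLocFn`, `DomD`,
`setDist`, `normHGHDS` (`B3Ineq25SmoothLocalization`, p349593); the typer's `ScaledKernels.Ineq25At`/`Ineq25`; r14's `Interior`, `regRegionKernels`;
p33 g58's `Interior.mono`; the engine `B3Norm132TwoFamilyMultiplier` (p40 g72: `kv`, `kd`, `normM2`, `normM2_le_of_entries`, `star_kv`, `DomG`); the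
symmetry of the (I.2.20) operators `B1Eq230FluctCovPos.siteInner_covOpK_comm`/`siteInner_propagatorK_comm`.

## What is printed (verbatim)

(1.16) p. 414 [PDF 4]: *"Finally if we expand the propagator G_k(Ω, Ã + B̃) using the formulas (I.3.44), (I.3.45), then in the last term of this
expansion, equal to [G_k(Ω,B̃)V_k(Ã,B̃)]^n G_k(Ω,Ã+B̃)[V_k(Ã,B̃)G_k(Ω,B̃)]^{n′}, (1.16) we have the propagator G_k(Ω,Ã+B̃). There are several possible ways
of treating the above expression. Perhaps the simplest way is to treat it as an external field, because for n, n′ sufficiently large, a kernel of the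
operator (1.16) is a sufficiently regular function of both variables. More exactly the Hölder norms of the covariant derivatives of this kernel, the norms
defined for example in the inequalities (I.2.24) and (I.2.25) of Proposition I.2.1, are exponentially decaying with the distance of the arguments and are
uniformly bounded by O(1)(e(L^kε)^{1−α})^{n+n′}, where α > 0 but can be arbitrarily small. This estimate follows easily from the properties of the
propagators G_k(Ω,A) proved in the next paper."*;  (1.32) p. 420 [PDF 10]: *"‖f‖_{1,α} = sup_x|f(x)| + sup_{x,μ}|(D^η_{B̃,μ}f)(x)| +
sup_{x,x′,μ}|x − x′|^{−α}|U(B̃(Γ_{x,x′}))(D^η_{B̃,μ}f)(x′) − (D^η_{B̃,μ}f)(x)|, (1.32) … This definition extends in a natural way to functions of many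
variables."*; p. 420: *"we localize, taking for each leg of the vector field a smooth partition of unity satisfying the condition that a support of each
function is contained in a cube with sides of length 2 … we multiply it by a smooth function h such that h = 1 on □(v) and h = 0 outside some neighborhood
of □(v)"*;  (2.5) p. 424 [PDF 14]: *"In the estimates we treat them as external fields and we use the inequalities: ‖h(an operator δG_k(Ω,Ω₂,B̃) or
(1.16))h′‖_{1,α} ≤ O(e^{−δ₀dist(Ω₂,∂Ω)} or (e(L^kε)p(L^kε))^{n+n′})e^{−δ₀dist(supp h, supp h′)}, (2.5) where h, h′ are functions giving the localizations of
the vertices."*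

## What this file proves, and how

§1 THE OPERATOR (1.16) AND ITS ADJOINT: `⟨f, V_k g⟩ = ⟨V_k f, g⟩` (`V_k = H_k(B̃) − H_k(Ã+B̃)`, both symmetric for (I.1.5)) and
**`siteInner_op116_adj`**: `⟨f, (1.16)_{n,n′} g⟩ = ⟨(1.16)_{n′,n} f, g⟩` — the (I.1.5)-adjoint of the operator (1.16) is the operator with `n` and `n′`
EXCHANGED (p40 g70's ring identity `star_term116` on the carrier, by induction on `n, n′` from `op116_succ_left`/`op116_succ_right`); hence
`star_kv116`: `(1.16)_{n,n′}(x,y)^* = (1.16)_{n′,n}(y,x)` for the blocks — the kernel is a genuinely TWO-variable (non-symmetric) object for `n ≠ n′`.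
§2 THE NORM: `normHGH116S … n n′ α h h′ = ‖h(1.16)_{n,n′}h′‖_{1,α}` := the two-family (1.32) norm `normM2` (whole product lattice, transports
`U(B̃(Γ))∘·∘U(B̃(Γ′))^*`, covariant `η`-derivatives in BOTH variables by the product rule) of the field `F(x,y) = (1.16)_{n,n′}(x,y)` in the print's
`η`-units (`kv`/`kd`), ROW family = the blocks of `(1.16)_{n,n′}`, COLUMN family = the blocks of `(1.16)_{n′,n}` (= the transposed field, §1); the two
honest readings `derivHGH116_inl`/`derivHGH116_inr`: on a row bond the derivative datum IS `L^k(U(εB̃_b)G(x+e_μ,x′) − G(x,x′))`, on a column bond it IS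
`L^k(U(εB̃_b)G(x,x′+e_ν)^* − G(x,x′)^*)`.
§3 THE CARRIER **`sect2Smooth116 hL1 C Ω Ω₂ Ã B̃ m² a k K₀ r₀ m c₁ c₂ e_R p_R : ScaledKernels`** = p33 g61's `sect2DeltaSmooth hL1 C Ω Ω₂ B̃ …` (LocFn =
the smooth bumps on admissible domains of interior points of `Ω₂`, `distSupp = setDist`, `distΩ₂ := r₀`, `normDeltaG = ‖hδG_k(Ω,Ω₂,B̃)h′‖_{1,α}`) with
`eRun := e_R`, `pRun := p_R` (carrier parameters: print's `e(L^kε)`, `p(L^kε)`) and THE GENUINE `norm116 α n n′ h h′ := normHGH116S … n n′ α h h′`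
(the first carrier in the tree whose (1.16) field is not `0`); `ineq25At_smooth116_iff` unfolds `Ineq25At`.
§4 **`ineq25At_op116_smooth_of_bounds`**: for `Ω₂ ⊆ Ω`, `1 ≤ k ≤ K`, `L ≥ 2`, `0 ≤ α ≤ 1`, given (i) p33's clause for `δG_k` on its own carrier
(`(sect2DeltaSmooth …).Ineq25 α δ_G C_G`, i.e. p33's HYPOTHESIS-FREE `ineq25_smooth_regularNested` at the plug) and (ii) the EIGHT KERNEL ENTRIES of
`T = (1.16)_{n,n′}` AND `T′ = (1.16)_{n′,n}` at interior points of `Ω` in p33's currency with the factor `(e_Rp_R)^{n+n′}` — value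
`(ε^d)^{−1}Σ_{i′}‖(Te_{(x′,i′)})(x)‖ ≤ C_V(e_Rp_R)^{n+n′}(L^kε)²((L^kε)^d)^{−1}e^{−δ|x−x′|/L^k}`, row derivative, transported Hölder difference of the row
derivative along admissible contours, mixed `D_xTD^*_{x′}` (binders `hV hV' hDv hDv' hH hH' hM hM'` = p33's `ineq25_smooth_of_bounds` shapes with `dG ↦ T`,
no margin factors) —: `(sect2Smooth116 …).Ineq25At n n′ α (min δ_G δ) (C_G + (K(c₁,c₂+2c₁,d,m)(C_V+C_D) + C_H + dmC_M))`; and the TORUS form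
`ineq25At_op116_smooth_torus_of_bounds` (`Ω = T_ε`: entries unguarded, `interior_univ`).  FILE 5(b) (after r14's FILE 3(b) value clause
`kernel116_…_regularTorus` and p35's FILE 4 derivative/Hölder/mixed clauses land): their theorems ARE `hV…hM'` at `(n,n′)` and `(n′,n)`.

## Honest scope / declared divergences (F7)

(i) The kernel entries of (1.16) and p33's `δG_k` clause are HYPOTHESES here (no regularity/smallness of `Ã`, `B̃` enters this file); the member is
hypothesis-free only after FILE 5(b).  (ii) `e_R`, `p_R` are carrier PARAMETERS standing for print's `e(L^kε)`, `p(L^kε)` ((I.3.38), (I.3.43)); the plug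
fixes them (r14: `t = L^kε·|e|·s`).  (iii) "Smooth" = p40's discrete class at exponent `1` (constants `c₁, c₂`), supports in p33's admissible domains of
interior points of `Ω₂ ⊆ Ω` (so the (1.16) entries are needed at interior points of `Ω` only; torus: everywhere); `distSupp` = lattice distance of the
support domains.  (iv) The (1.32) norm of the two-variable kernel is the product-lattice SUM norm with covariant derivatives and transports in both
variables at the background `B̃` (as for (3.1), p40 g68/g69, and (2.5) clause (i), p33 g60/g61); constants may depend on `α, n, n′, K₀, m, c₁, c₂`
(`Ineq25At`, G-B3-11/G-B3-15).  No `def … : Prop`, no new named fact (`normHGH116S`, `sect2Smooth116` are concrete data); axioms standard.  Value = the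
assembly step of one located estimate of B3 §2 — the GENUINE `norm116` — NOT summit progress; no head claim before FILE 5(b).
-/

noncomputable section

open scoped BigOperators InnerProductSpace Matrix

namespace Literature.MathematicalPhysics.QuantumFieldTheory.Balaban1983to89.B3Ineq25Op116Smooth

open HiggsLattice (ChargeData ScalarField siteInner covDeriv)
open HiggsCovariance (propagatorK E)
open B1Eq230FluctCov (Ix cb)
open B1Eq230FluctCovPos (siteInner_covOpK_comm siteInner_propagatorK_comm)
open B1TorusChainTransport (hol)
open B3Sect2StatementsPart2 (ScaledKernels)
open B3Ineq210RegularTorus (mesh_eq_pow_mul)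
open B3Ineq210RegularRegion (Interior interior_univ)
open B3Ineq211RegularTorus (IsAdm)
open B3Ineq210MixedRegularTorus (onb dip)
open B3Ineq31RegularTorus (two_lt_sitesPerDir cpath PSite PBd unitV unitD)
open B3Ineq31SmoothLocalization (dEta IsSmoothLoc smoothConst smoothConst_pos)
open B3Norm132SmoothMultiplier (kerM)
open B3Ineq25SmoothLocalization (DomD setDist setDist_nonneg pow_mul_setDist_le SmoothLocFn sect2DeltaSmooth normHGHDS)
open B3Norm132TwoFamilyMultiplier (vblk dblk kv kd star_kv derivM2 normM2 normM2_le_of_entries derivM2_inl derivM2_inr DomG)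
open B3Eq116TwoSidedExpansion (opV op116 op116_zero_zero op116_succ_left op116_succ_right)

variable {P : HiggsLattice.Params} {N : ℕ}

/-! ## §1 The operator (1.16) and its (I.1.5)-adjoint: `n` and `n′` exchanged -/

section Adjoint

variable (C : ChargeData N) (Ω : Finset (HiggsLattice.Site P 0)) (A B : HiggsLattice.VecField P 0) (msq a : ℝ) (k : ℕ)

/-- **`V_k(Ã,B̃) = H_k(B̃) − H_k(Ã+B̃)` is symmetric for (I.1.5)** (both operators (I.2.20) are, `siteInner_covOpK_comm`).
[cite: Balaban1982Higgs1, (2.20) p.610, (3.44) p.619] [cite: Balaban1983Higgs3, (1.16) p.414] -/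
theorem siteInner_opV_adj (f g : ScalarField P 0 N) :
    siteInner f (opV C Ω A B msq a k g) = siteInner (opV C Ω A B msq a k f) g := by
  rw [HiggsFluctMeasurePos.siteInner_comm (opV C Ω A B msq a k f) g]
  simp only [opV, LinearMap.sub_apply, HiggsFluctMeasurePos.siteInner_sub_right]
  rw [siteInner_covOpK_comm C Ω B msq a k f g, siteInner_covOpK_comm C Ω (A + B) msq a k f g]

/-- **The (I.1.5)-adjoint of the operator (1.16) is the operator (1.16) with `n` and `n′` exchanged**:
`⟨f, [G(B̃)V]^n G(Ã+B̃)[VG(B̃)]^{n′} g⟩ = ⟨[G(B̃)V]^{n′} G(Ã+B̃)[VG(B̃)]^{n} f, g⟩` (all three factors symmetric; p40 g70's `star_term116` on the carrier).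
In particular the kernel of (1.16) is symmetric only for `n = n′`: *"a kernel of the operator (1.16) is a … function of both variables"*.
[cite: Balaban1983Higgs3, (1.16) p.414] [cite: Balaban1982Higgs1, (2.20) p.610] -/
theorem siteInner_op116_adj (n n' : ℕ) (f g : ScalarField P 0 N) :
    siteInner f (op116 C Ω A B msq a k n n' g) = siteInner (op116 C Ω A B msq a k n' n f) g := by
  have aG : ∀ (X : HiggsLattice.VecField P 0) (f g : ScalarField P 0 N),
      siteInner f (propagatorK C Ω X msq a k g) = siteInner (propagatorK C Ω X msq a k f) g := fun X f g => by
    rw [siteInner_propagatorK_comm C Ω X msq a k f g, HiggsFluctMeasurePos.siteInner_comm]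
  have aV : ∀ f g : ScalarField P 0 N, siteInner f (opV C Ω A B msq a k g) = siteInner (opV C Ω A B msq a k f) g :=
    siteInner_opV_adj C Ω A B msq a k
  induction n generalizing n' f g with
  | zero =>
    induction n' generalizing f g with
    | zero => rw [op116_zero_zero]; exact aG _ f g
    | succ n' ih =>
      rw [op116_succ_right, op116_succ_left, Module.End.mul_apply, Module.End.mul_apply, Module.End.mul_apply,
        Module.End.mul_apply, ih, aV, aG]
  | succ n ih =>
    rw [op116_succ_left, op116_succ_right, Module.End.mul_apply, Module.End.mul_apply, Module.End.mul_apply,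
      Module.End.mul_apply, aG, aV, ih]

/-- Hence for the blocks in the print's units: `(1.16)_{n,n′}(x,y)^* = (1.16)_{n′,n}(y,x)` — the COLUMN reading of the two-variable field
`(x,y) ↦ (1.16)_{n,n′}(x,y)` is the ROW reading of `(1.16)_{n′,n}`. [cite: Balaban1983Higgs3, (1.16) p.414, (1.32) p.420] [cite: Balaban1982Higgs1, (2.20) p.610] -/
theorem star_kv116 (n n' : ℕ) (x y : HiggsLattice.Site P 0) :
    star (kv k (op116 C Ω A B msq a k n n') x y) = kv k (op116 C Ω A B msq a k n' n) y x :=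
  star_kv (siteInner_op116_adj C Ω A B msq a k n n') x y

end Adjoint

/-! ## §2 `‖h(1.16)_{n,n′}h′‖_{1,α}` with smooth localization functions: the two-family (1.32) norm of the kernel of (1.16) -/

section Norm

variable (C : ChargeData N) (Ω : Finset (HiggsLattice.Site P 0)) (A B : HiggsLattice.VecField P 0) (msq a : ℝ) (k : ℕ) (n n' : ℕ)

/-- **`‖h·(the operator (1.16) with exponents n, n′)·h′‖_{1,α}` WITH SMOOTH LOCALIZATION FUNCTIONS**: the printed (1.32) SUM norm of the localized
two-variable field `G = (h ⊗ h′)·(1.16)_{n,n′}(·,·)` (print's `η`-units) over the WHOLE product lattice `T_η × T_η` — all sites, all `2d` directions of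
product bonds with the covariant `η`-derivatives at the background `B̃` BY THE PRODUCT RULE in each variable, Hölder quotients over same-direction pairs
at the sup-distance, transports `U(B̃(Γ))∘·∘U(B̃(Γ′))^*` —: the two-family `normM2` at the blocks of `(1.16)_{n,n′}` (rows) and of its adjoint
`(1.16)_{n′,n}` (columns). [cite: Balaban1983Higgs3, (2.5) p.424, (1.16) p.414, (1.32) p.420] -/
def normHGH116S (α : ℝ) (h h' : HiggsLattice.Site P 0 → ℝ) : ℝ :=
  normM2 C B k (kv k (op116 C Ω A B msq a k n n')) (kd k C B (op116 C Ω A B msq a k n n'))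
    (kv k (op116 C Ω A B msq a k n' n)) (kd k C B (op116 C Ω A B msq a k n' n)) α h h'

variable {C Ω A B msq a k n n'}

/-- `normHGH116S` unfolds to the two-family norm of the engine. [cite: Balaban1983Higgs3, (1.32) p.420] -/
theorem normHGH116S_eq (α : ℝ) (h h' : HiggsLattice.Site P 0 → ℝ) :
    normHGH116S C Ω A B msq a k n n' α h h'
      = normM2 C B k (kv k (op116 C Ω A B msq a k n n')) (kd k C B (op116 C Ω A B msq a k n n'))
          (kv k (op116 C Ω A B msq a k n' n)) (kd k C B (op116 C Ω A B msq a k n' n)) α h h' :=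
  rfl

/-- `unitD·ε^{−1} = L^k·unitV`. [folklore] -/
private theorem unitD_mul_inv_mesh (P : HiggsLattice.Params) (k : ℕ) : unitD P k * (P.mesh 0)⁻¹ = (P.L : ℝ) ^ k * unitV P k := by
  unfold unitV unitD
  rw [mesh_eq_pow_mul P k]
  have hε : P.mesh 0 ≠ 0 := (P.mesh_pos 0).ne'
  have hL : (P.L : ℝ) ^ k ≠ 0 := pow_ne_zero _ (by have := P.hL; positivity)
  field_simp

/-- the derivative block in the print's units is `L^k` times the covariant difference of the value blocks (`unitD·ε^{−1} = L^k·unitV`), for any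
operator `T`. [cite: Balaban1982Higgs1, (1.7) p.605] [cite: Balaban1983Higgs3, (1.32) p.420] -/
theorem kd_eq (T : Module.End ℝ (ScalarField P 0 N)) (b : HiggsLattice.PBond P 0) (y : HiggsLattice.Site P 0) :
    kd k C B T b y = ((P.L : ℝ) ^ k) • ((C.U (P.mesh 0) (B b)).comp (kv k T b.tgt y) - kv k T b.src y) := by
  rw [kd, dblk, smul_smul, unitD_mul_inv_mesh, ← smul_smul]
  simp only [kv, ContinuousLinearMap.comp_smul]
  rw [smul_sub]

/-- **The datum on a ROW bond IS the covariant difference quotient of the localized field in the first variable**: for the row bond `μ` over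
`(x,x′)`, `derivM2(c) = L^k·(U(εB̃_{⟨x,μ⟩})G(x+e_μ,x′) − G(x,x′))`, `G = (h ⊗ h′)·(1.16)_{n,n′}`.
[cite: Balaban1983Higgs3, (1.32) p.420] [cite: Balaban1982Higgs1, (1.7) p.605] -/
theorem derivHGH116_inl (h h' : HiggsLattice.Site P 0 → ℝ) (μ : Fin P.d) (x x' : HiggsLattice.Site P 0) :
    derivM2 k (kv k (op116 C Ω A B msq a k n n')) (kd k C B (op116 C Ω A B msq a k n n'))
        (kv k (op116 C Ω A B msq a k n' n)) (kd k C B (op116 C Ω A B msq a k n' n)) h h' (Sum.inl (μ, (x, x')))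
      = ((P.L : ℝ) ^ k) • ((C.U (P.mesh 0) (B ⟨x, μ⟩)).comp (kerM (kv k (op116 C Ω A B msq a k n n')) h h' (x.shift μ, x'))
          - kerM (kv k (op116 C Ω A B msq a k n n')) h h' (x, x')) := by
  rw [derivM2_inl, kd_eq]
  simp only [kerM, dEta, HiggsLattice.PBond.tgt]
  simp only [ContinuousLinearMap.comp_smul]
  module

/-- `G(x,y)^* = h(x)h′(y)·(1.16)_{n′,n}(y,x)` — the transposed localized field is the localized field of the adjoint.
[cite: Balaban1983Higgs3, (1.16) p.414] [cite: Balaban1982Higgs1, (2.20) p.610] -/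
theorem star_kerHGH116 (h h' : HiggsLattice.Site P 0 → ℝ) (x y : HiggsLattice.Site P 0) :
    star (kerM (kv k (op116 C Ω A B msq a k n n')) h h' (x, y)) = (h x * h' y) • kv k (op116 C Ω A B msq a k n' n) y x := by
  rw [kerM, star_smul, star_trivial, star_kv116]

/-- **The datum on a COLUMN bond IS the covariant difference quotient of the TRANSPOSED localized field in the second variable**: for the column
bond `ν` over `(x,x′)`, `derivM2(c) = L^k·(U(εB̃_{⟨x′,ν⟩})G(x,x′+e_ν)^* − G(x,x′)^*)` (an equation by `star_kerHGH116`: the column family is the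
adjoint's row family). [cite: Balaban1983Higgs3, (1.32) p.420] [cite: Balaban1982Higgs1, (2.20) p.610] -/
theorem derivHGH116_inr (h h' : HiggsLattice.Site P 0 → ℝ) (ν : Fin P.d) (x x' : HiggsLattice.Site P 0) :
    derivM2 k (kv k (op116 C Ω A B msq a k n n')) (kd k C B (op116 C Ω A B msq a k n n'))
        (kv k (op116 C Ω A B msq a k n' n)) (kd k C B (op116 C Ω A B msq a k n' n)) h h' (Sum.inr (ν, (x, x')))
      = ((P.L : ℝ) ^ k) • ((C.U (P.mesh 0) (B ⟨x', ν⟩)).comp (star (kerM (kv k (op116 C Ω A B msq a k n n')) h h' (x, x'.shift ν)))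
          - star (kerM (kv k (op116 C Ω A B msq a k n n')) h h' (x, x'))) := by
  rw [star_kerHGH116, star_kerHGH116, derivM2_inr, kd_eq]
  simp only [dEta, HiggsLattice.PBond.tgt]
  simp only [ContinuousLinearMap.comp_smul]
  module

end Norm

/-! ## §3 The carrier of (2.5) with smooth localization functions AND the genuine (1.16) field -/

section Carrier

variable {k K₀ r₀ m : ℕ}

/-- **The concrete carrier of B3 (2.5), BOTH ALTERNATIVES, WITH SMOOTH LOCALIZATION FUNCTIONS**, for nested regions `Ω₂ ⊆ Ω ⊆ T_η`, backgrounds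
`Ã = A` (small field) and `B̃ = B`, scale `k`, cube parameter `K₀`, margin `r₀`, support size `m`, bump constants `c₁, c₂`, running constants
`e_R = e(L^kε)`, `p_R = p(L^kε)`: p33 g61's `sect2DeltaSmooth hL1 C Ω Ω₂ B̃ …` (LocFn = the smooth bumps on admissible domains, `distSupp = setDist`,
`distΩ₂ := r₀`, `normDeltaG α h h′ = ‖hδG_k(Ω,Ω₂,B̃)h′‖_{1,α}`, (2.10) fields = r14's `regRegionKernels` for `Ω₂`) with `eRun := e_R`, `pRun := p_R` and
THE GENUINE (1.16) FIELD `norm116 α n n′ h h′ = ‖h(1.16)_{n,n′}h′‖_{1,α}` (`normHGH116S`).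
[cite: Balaban1983Higgs3, (2.5) p.424, (1.16) p.414, p.420] -/
def sect2Smooth116 (hL1 : 1 < P.L) (C : ChargeData N) (Ω Ω₂ : Finset (HiggsLattice.Site P 0)) (A B : HiggsLattice.VecField P 0)
    (msq a : ℝ) (k K₀ r₀ m : ℕ) (c₁ c₂ eR pR : ℝ) : ScaledKernels :=
  { sect2DeltaSmooth hL1 C Ω Ω₂ B msq a k K₀ r₀ m c₁ c₂ with
    eRun := eR
    pRun := pR
    norm116 := fun α n n' f f' => normHGH116S C Ω A B msq a k n n' α f.fn f'.fn }

variable {hL1 : 1 < P.L} {C : ChargeData N} {Ω Ω₂ : Finset (HiggsLattice.Site P 0)} {A B : HiggsLattice.VecField P 0} {msq a : ℝ}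
  {c₁ c₂ eR pR : ℝ}

/-- **`(2.5)` at fixed orders `(n, n′)` for the carrier unfolds to**: p33's clause for `‖hδG_k(Ω,Ω₂,B̃)h′‖_{1,α}` (first conjunct) AND the bound
`‖h(1.16)_{n,n′}h′‖_{1,α} ≤ C·(e_Rp_R)^{n+n′}·e^{−δ₀dist(supp h,supp h′)}` for every pair of smooth localization functions (second conjunct).
[cite: Balaban1983Higgs3, (2.5) p.424] -/
theorem ineq25At_smooth116_iff (n n' : ℕ) (α δ₀ Cst : ℝ) :
    (sect2Smooth116 hL1 C Ω Ω₂ A B msq a k K₀ r₀ m c₁ c₂ eR pR).Ineq25At n n' α δ₀ Cst ↔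
      (∀ f f' : SmoothLocFn k K₀ Ω₂ r₀ m c₁ c₂,
        normHGHDS C Ω Ω₂ B msq a k α f.fn f'.fn
          ≤ Cst * Real.exp (-(δ₀ * (r₀ : ℝ))) * Real.exp (-(δ₀ * setDist k f.supp f'.supp))) ∧
      (∀ f f' : SmoothLocFn k K₀ Ω₂ r₀ m c₁ c₂,
        normHGH116S C Ω A B msq a k n n' α f.fn f'.fn
          ≤ Cst * (eR * pR) ^ (n + n') * Real.exp (-(δ₀ * setDist k f.supp f'.supp))) :=
  Iff.rfl

/-- The first clause of the carrier's `Ineq25At` IS the first clause of p33's `sect2DeltaSmooth` carrier (same fields). [cite: Balaban1983Higgs3, (2.5) p.424] -/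
theorem ineq25_delta_iff (α δ₀ Cst : ℝ) :
    (sect2DeltaSmooth hL1 C Ω Ω₂ B msq a k K₀ r₀ m c₁ c₂).Ineq25 α δ₀ Cst ↔
      (∀ f f' : SmoothLocFn k K₀ Ω₂ r₀ m c₁ c₂,
        normHGHDS C Ω Ω₂ B msq a k α f.fn f'.fn
          ≤ Cst * Real.exp (-(δ₀ * (r₀ : ℝ))) * Real.exp (-(δ₀ * setDist k f.supp f'.supp))) ∧
      (∀ (n n' : ℕ) (_f _f' : SmoothLocFn k K₀ Ω₂ r₀ m c₁ c₂),
        (0 : ℝ) ≤ Cst * ((0 : ℝ) * 0) ^ (n + n') * Real.exp (-(δ₀ * setDist k _f.supp _f'.supp))) :=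
  Iff.rfl

/-- The (2.10) clause of the carrier IS r14's region statement for `Ω₂` at `B̃` (same fields). [cite: Balaban1983Higgs3, (2.10) p.426] -/
theorem ineq210_smooth116_iff (δ₁ Cst : ℝ) :
    (sect2Smooth116 hL1 C Ω Ω₂ A B msq a k K₀ r₀ m c₁ c₂ eR pR).Ineq210 δ₁ Cst ↔
      (B3Ineq210RegularRegion.regRegionKernels hL1 C Ω₂ B msq a k K₀).Ineq210 δ₁ Cst :=
  Iff.rfl

end Carrier

/-! ## §4 (2.5) at orders `(n, n′)`, both clauses, from p33's `δG_k` clause and the kernel entries of (1.16) -/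

section Main

variable {k K₀ r₀ m : ℕ} {hL1 : 1 < P.L} {C : ChargeData N} {Ω Ω₂ : Finset (HiggsLattice.Site P 0)} {A B : HiggsLattice.VecField P 0}
  {msq a : ℝ} {c₁ c₂ eR pR : ℝ}

/-- weakening a decay rate. [folklore] -/
private theorem exp_rate_mono {δ δ' t : ℝ} (h : δ ≤ δ') (ht : 0 ≤ t) : Real.exp (-(δ' * t)) ≤ Real.exp (-(δ * t)) := by
  rw [Real.exp_le_exp]; nlinarith

set_option maxHeartbeats 800000 in
/-- **INEQUALITY (2.5) OF [B3] AT FIXED ORDERS `(n, n′)` — BOTH ALTERNATIVES — WITH PRINT'S SMOOTH LOCALIZATION FUNCTIONS, FROM THE KERNEL ENTRIES OF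
THE OPERATOR (1.16).**  Nested regions `Ω₂ ⊆ Ω ⊆ T_ε`, `1 ≤ k ≤ K`, `L ≥ 2`, `0 ≤ α ≤ 1`, bump constants `c₁, c₂ ≥ 0`, `e_Rp_R ≥ 0`.  GIVEN (i) the
`δG_k(Ω,Ω₂,B̃)` clause on p33 g61's carrier at `(δ_G, C_G)`, `C_G ≥ 0` (p33's `ineq25_smooth_regularNested`, hypothesis-free, at the plug), and (ii) the
four kernel entries — value, row derivative, transported Hölder difference of the row derivative (admissible contours), mixed `D_xTD^*_{x′}` — of
`T = (1.16)_{n,n′}` AND of `T′ = (1.16)_{n′,n}` at interior points of `Ω`, rate `δ ≥ 0`, constants `C_V, C_D, C_H, C_M ≥ 0` times `(e_Rp_R)^{n+n′}`, in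
p33's currency (print: *"the Hölder norms of the covariant derivatives of this kernel … are exponentially decaying with the distance of the arguments and
are uniformly bounded by O(1)(e(L^kε)^{1−α})^{n+n′}"*, p. 414) — THEN
`(sect2Smooth116 …).Ineq25At n n′ α (min δ_G δ) (C_G + K(c₁,c₂+2c₁,d,m)(C_V+C_D) + C_H + dmC_M)`, i.e. clause (i) AND
`‖h(1.16)_{n,n′}h′‖_{1,α} ≤ C·(e_Rp_R)^{n+n′}·e^{−δ₀dist(supp h,supp h′)}` for ALL pairs of smooth localization functions of the carrier.
[cite: Balaban1983Higgs3, (2.5) p.424, (1.16) p.414, (1.32) p.420, p.420] [cite: Balaban1982Higgs1, Prop. 2.1 p.610] -/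
theorem ineq25At_op116_smooth_of_bounds (hL2 : 2 ≤ P.L) (hk1 : 1 ≤ k) (hkK : k ≤ P.K) (hΩ : Ω₂ ⊆ Ω) (n n' : ℕ)
    {α δG CG δ CV CD CH CM : ℝ} (hα0 : 0 ≤ α) (hα1 : α ≤ 1) (hc₁ : 0 ≤ c₁) (hc₂ : 0 ≤ c₂) (ht : 0 ≤ eR * pR)
    (hCG : 0 ≤ CG) (hδ : 0 ≤ δ) (hCV : 0 ≤ CV) (hCD : 0 ≤ CD) (hCH : 0 ≤ CH) (hCM : 0 ≤ CM)
    (hδG : (sect2DeltaSmooth hL1 C Ω Ω₂ B msq a k K₀ r₀ m c₁ c₂).Ineq25 α δG CG)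
    (hV : ∀ (x x' : HiggsLattice.Site P 0), Interior k K₀ Ω x → Interior k K₀ Ω x' →
      (P.mesh 0 ^ P.d)⁻¹ * ∑ i' : Ix N, ‖op116 C Ω A B msq a k n n' (cb P N 0 (x', i')) x‖
        ≤ CV * (eR * pR) ^ (n + n') * (P.mesh k ^ 2 * (P.mesh k ^ P.d)⁻¹) *
          Real.exp (-(δ * ((HiggsLattice.Site.tdist x x' : ℝ) / (P.L : ℝ) ^ k))))
    (hV' : ∀ (x x' : HiggsLattice.Site P 0), Interior k K₀ Ω x → Interior k K₀ Ω x' →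
      (P.mesh 0 ^ P.d)⁻¹ * ∑ i' : Ix N, ‖op116 C Ω A B msq a k n' n (cb P N 0 (x', i')) x‖
        ≤ CV * (eR * pR) ^ (n + n') * (P.mesh k ^ 2 * (P.mesh k ^ P.d)⁻¹) *
          Real.exp (-(δ * ((HiggsLattice.Site.tdist x x' : ℝ) / (P.L : ℝ) ^ k))))
    (hDv : ∀ (μ : Fin P.d) (x x' : HiggsLattice.Site P 0), Interior k K₀ Ω x → Interior k K₀ Ω x' →
      (P.mesh 0 ^ P.d)⁻¹ * ∑ i' : Ix N, ‖covDeriv C B (op116 C Ω A B msq a k n n' (cb P N 0 (x', i'))) ⟨x, μ⟩‖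
        ≤ CD * (eR * pR) ^ (n + n') * (P.mesh k * (P.mesh k ^ P.d)⁻¹) *
          Real.exp (-(δ * ((HiggsLattice.Site.tdist x x' : ℝ) / (P.L : ℝ) ^ k))))
    (hDv' : ∀ (μ : Fin P.d) (x x' : HiggsLattice.Site P 0), Interior k K₀ Ω x → Interior k K₀ Ω x' →
      (P.mesh 0 ^ P.d)⁻¹ * ∑ i' : Ix N, ‖covDeriv C B (op116 C Ω A B msq a k n' n (cb P N 0 (x', i'))) ⟨x, μ⟩‖
        ≤ CD * (eR * pR) ^ (n + n') * (P.mesh k * (P.mesh k ^ P.d)⁻¹) *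
          Real.exp (-(δ * ((HiggsLattice.Site.tdist x x' : ℝ) / (P.L : ℝ) ^ k))))
    (hH : ∀ (μ : Fin P.d) (x₁ x₂ x' : HiggsLattice.Site P 0) (Γ : List (HiggsLattice.Site P 0)),
      Interior k K₀ Ω x₁ → Interior k K₀ Ω x₂ → Interior k K₀ Ω x' → x₁ ≠ x₂ → IsAdm x₁ x₂ Γ →
      (P.mesh 0 ^ P.d)⁻¹ * ∑ i' : Ix N, ‖hol C B x₁ Γ (covDeriv C B (op116 C Ω A B msq a k n n' (cb P N 0 (x', i'))) ⟨x₂, μ⟩)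
          - covDeriv C B (op116 C Ω A B msq a k n n' (cb P N 0 (x', i'))) ⟨x₁, μ⟩‖
        ≤ (P.mesh 0 * (HiggsLattice.Site.tdist x₁ x₂ : ℝ)) ^ α *
          (CH * (eR * pR) ^ (n + n') * (P.mesh k * (P.mesh k ^ P.d)⁻¹ * (P.mesh k ^ α)⁻¹)) *
          Real.exp (-(δ * (min (HiggsLattice.Site.tdist x₁ x' : ℝ) (HiggsLattice.Site.tdist x₂ x' : ℝ) / (P.L : ℝ) ^ k))))
    (hH' : ∀ (μ : Fin P.d) (x₁ x₂ x' : HiggsLattice.Site P 0) (Γ : List (HiggsLattice.Site P 0)),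
      Interior k K₀ Ω x₁ → Interior k K₀ Ω x₂ → Interior k K₀ Ω x' → x₁ ≠ x₂ → IsAdm x₁ x₂ Γ →
      (P.mesh 0 ^ P.d)⁻¹ * ∑ i' : Ix N, ‖hol C B x₁ Γ (covDeriv C B (op116 C Ω A B msq a k n' n (cb P N 0 (x', i'))) ⟨x₂, μ⟩)
          - covDeriv C B (op116 C Ω A B msq a k n' n (cb P N 0 (x', i'))) ⟨x₁, μ⟩‖
        ≤ (P.mesh 0 * (HiggsLattice.Site.tdist x₁ x₂ : ℝ)) ^ α *
          (CH * (eR * pR) ^ (n + n') * (P.mesh k * (P.mesh k ^ P.d)⁻¹ * (P.mesh k ^ α)⁻¹)) *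
          Real.exp (-(δ * (min (HiggsLattice.Site.tdist x₁ x' : ℝ) (HiggsLattice.Site.tdist x₂ x' : ℝ) / (P.L : ℝ) ^ k))))
    (hM : ∀ (μ ν : Fin P.d) (x x' : HiggsLattice.Site P 0), Interior k K₀ Ω x → Interior k K₀ Ω x' →
      (P.mesh 0 ^ P.d)⁻¹ * ((P.mesh 0)⁻¹ *
          ∑ i : Ix N, ‖covDeriv C B (op116 C Ω A B msq a k n n' (dip C B ⟨x', ν⟩ (onb N i))) ⟨x, μ⟩‖)
        ≤ CM * (eR * pR) ^ (n + n') * (P.mesh k ^ P.d)⁻¹ *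
          Real.exp (-(δ * ((HiggsLattice.Site.tdist x x' : ℝ) / (P.L : ℝ) ^ k))))
    (hM' : ∀ (μ ν : Fin P.d) (x x' : HiggsLattice.Site P 0), Interior k K₀ Ω x → Interior k K₀ Ω x' →
      (P.mesh 0 ^ P.d)⁻¹ * ((P.mesh 0)⁻¹ *
          ∑ i : Ix N, ‖covDeriv C B (op116 C Ω A B msq a k n' n (dip C B ⟨x', ν⟩ (onb N i))) ⟨x, μ⟩‖)
        ≤ CM * (eR * pR) ^ (n + n') * (P.mesh k ^ P.d)⁻¹ *
          Real.exp (-(δ * ((HiggsLattice.Site.tdist x x' : ℝ) / (P.L : ℝ) ^ k)))) :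
    (sect2Smooth116 hL1 C Ω Ω₂ A B msq a k K₀ r₀ m c₁ c₂ eR pR).Ineq25At n n' α (min δG δ)
      (CG + (smoothConst P.d m c₁ (c₂ + 2 * c₁) * (CV + CD) + (CH + P.d * m * CM))) := by
  have hS : ∀ μ, 2 < P.sitesPerDir 0 μ := two_lt_sitesPerDir (hk1.trans hkK) hL2
  set t : ℝ := (eR * pR) ^ (n + n') with htdef
  have ht0 : 0 ≤ t := pow_nonneg ht _
  set C116 : ℝ := smoothConst P.d m c₁ (c₂ + 2 * c₁) * (CV + CD) + (CH + P.d * m * CM) with hC116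
  have hK := smoothConst_pos P.d m hc₁ (by positivity : 0 ≤ c₂ + 2 * c₁)
  have hC116_0 : 0 ≤ C116 := by positivity
  have hleG : min δG δ ≤ δG := min_le_left _ _
  have hle : min δG δ ≤ δ := min_le_right _ _
  rw [ineq25At_smooth116_iff]
  refine ⟨fun f f' => ?_, fun f f' => ?_⟩
  · -- clause (i): p33's clause, constants weakened
    have h1 := ((ineq25_delta_iff (hL1 := hL1) (C := C) (Ω := Ω) (Ω₂ := Ω₂) (B := B) (msq := msq) (a := a) (k := k) (K₀ := K₀) (r₀ := r₀)
      (m := m) (c₁ := c₁) (c₂ := c₂) α δG CG).1 hδG).1 f f'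
    have hsd := setDist_nonneg k f.supp f'.supp
    calc normHGHDS C Ω Ω₂ B msq a k α f.fn f'.fn
        ≤ CG * Real.exp (-(δG * (r₀ : ℝ))) * Real.exp (-(δG * setDist k f.supp f'.supp)) := h1
      _ ≤ (CG + C116) * Real.exp (-(min δG δ * (r₀ : ℝ))) * Real.exp (-(min δG δ * setDist k f.supp f'.supp)) :=
          mul_le_mul (mul_le_mul (by linarith) (exp_rate_mono hleG (Nat.cast_nonneg _)) (Real.exp_pos _).le (by positivity))
            (exp_rate_mono hleG hsd) (Real.exp_pos _).le (by positivity)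
  · -- clause (ii): the two-family multiplier on the kernel entries of (1.16)
    have hsd := setDist_nonneg k f.supp f'.supp
    have hdom : DomG k (Interior k K₀ Ω) m f.supp :=
      (DomG.of_domD f.dom).mono fun x hx => B3DeltaGkMixedRegularRegion.Interior.mono hΩ hx
    have hdom' : DomG k (Interior k K₀ Ω) m f'.supp :=
      (DomG.of_domD f'.dom).mono fun x hx => B3DeltaGkMixedRegularRegion.Interior.mono hΩ hx
    have hmain := normM2_le_of_entries (C := C) (A := B) (T := op116 C Ω A B msq a k n n') (T' := op116 C Ω A B msq a k n' n)
      (Good := Interior k K₀ Ω) (siteInner_op116_adj C Ω A B msq a k n n') hS hα0 hα1 hδ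
      (by positivity : 0 ≤ CV * t) (by positivity : 0 ≤ CD * t) (by positivity : 0 ≤ CH * t) (by positivity : 0 ≤ CM * t) hc₁ hc₂
      hV hV' hDv hDv' hH hH' hM hM' hdom hdom' hsd (fun x hx x' hx' => pow_mul_setDist_le hx hx') f.smooth f'.smooth
    rw [normHGH116S]
    calc _ ≤ (smoothConst P.d m c₁ (c₂ + 2 * c₁) * (CV * t + CD * t) + (CH * t + P.d * m * (CM * t))) *
            Real.exp (-(δ * setDist k f.supp f'.supp)) := hmain
      _ = C116 * t * Real.exp (-(δ * setDist k f.supp f'.supp)) := by rw [hC116]; ring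
      _ ≤ (CG + C116) * t * Real.exp (-(min δG δ * setDist k f.supp f'.supp)) :=
          mul_le_mul (mul_le_mul_of_nonneg_right (by linarith) ht0) (exp_rate_mono hle hsd) (Real.exp_pos _).le (by positivity)

/-- **The TORUS form `Ω = T_ε`** (the case of r14's FILE 3(b) `B3Op116KernelRegularTorus`): every point is interior (`interior_univ`), so the eight
kernel entries of (1.16) are taken UNGUARDED, everything else as in `ineq25At_op116_smooth_of_bounds`.
[cite: Balaban1983Higgs3, (2.5) p.424, (1.16) p.414, (1.32) p.420] -/
theorem ineq25At_op116_smooth_torus_of_bounds (hL2 : 2 ≤ P.L) (hk1 : 1 ≤ k) (hkK : k ≤ P.K) (n n' : ℕ)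
    {α δG CG δ CV CD CH CM : ℝ} (hα0 : 0 ≤ α) (hα1 : α ≤ 1) (hc₁ : 0 ≤ c₁) (hc₂ : 0 ≤ c₂) (ht : 0 ≤ eR * pR)
    (hCG : 0 ≤ CG) (hδ : 0 ≤ δ) (hCV : 0 ≤ CV) (hCD : 0 ≤ CD) (hCH : 0 ≤ CH) (hCM : 0 ≤ CM)
    (hδG : (sect2DeltaSmooth hL1 C Finset.univ Ω₂ B msq a k K₀ r₀ m c₁ c₂).Ineq25 α δG CG)
    (hV : ∀ (x x' : HiggsLattice.Site P 0),
      (P.mesh 0 ^ P.d)⁻¹ * ∑ i' : Ix N, ‖op116 C Finset.univ A B msq a k n n' (cb P N 0 (x', i')) x‖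
        ≤ CV * (eR * pR) ^ (n + n') * (P.mesh k ^ 2 * (P.mesh k ^ P.d)⁻¹) *
          Real.exp (-(δ * ((HiggsLattice.Site.tdist x x' : ℝ) / (P.L : ℝ) ^ k))))
    (hV' : ∀ (x x' : HiggsLattice.Site P 0),
      (P.mesh 0 ^ P.d)⁻¹ * ∑ i' : Ix N, ‖op116 C Finset.univ A B msq a k n' n (cb P N 0 (x', i')) x‖
        ≤ CV * (eR * pR) ^ (n + n') * (P.mesh k ^ 2 * (P.mesh k ^ P.d)⁻¹) *
          Real.exp (-(δ * ((HiggsLattice.Site.tdist x x' : ℝ) / (P.L : ℝ) ^ k))))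
    (hDv : ∀ (μ : Fin P.d) (x x' : HiggsLattice.Site P 0),
      (P.mesh 0 ^ P.d)⁻¹ * ∑ i' : Ix N, ‖covDeriv C B (op116 C Finset.univ A B msq a k n n' (cb P N 0 (x', i'))) ⟨x, μ⟩‖
        ≤ CD * (eR * pR) ^ (n + n') * (P.mesh k * (P.mesh k ^ P.d)⁻¹) *
          Real.exp (-(δ * ((HiggsLattice.Site.tdist x x' : ℝ) / (P.L : ℝ) ^ k))))
    (hDv' : ∀ (μ : Fin P.d) (x x' : HiggsLattice.Site P 0),
      (P.mesh 0 ^ P.d)⁻¹ * ∑ i' : Ix N, ‖covDeriv C B (op116 C Finset.univ A B msq a k n' n (cb P N 0 (x', i'))) ⟨x, μ⟩‖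
        ≤ CD * (eR * pR) ^ (n + n') * (P.mesh k * (P.mesh k ^ P.d)⁻¹) *
          Real.exp (-(δ * ((HiggsLattice.Site.tdist x x' : ℝ) / (P.L : ℝ) ^ k))))
    (hH : ∀ (μ : Fin P.d) (x₁ x₂ x' : HiggsLattice.Site P 0) (Γ : List (HiggsLattice.Site P 0)), x₁ ≠ x₂ → IsAdm x₁ x₂ Γ →
      (P.mesh 0 ^ P.d)⁻¹ * ∑ i' : Ix N, ‖hol C B x₁ Γ (covDeriv C B (op116 C Finset.univ A B msq a k n n' (cb P N 0 (x', i'))) ⟨x₂, μ⟩)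
          - covDeriv C B (op116 C Finset.univ A B msq a k n n' (cb P N 0 (x', i'))) ⟨x₁, μ⟩‖
        ≤ (P.mesh 0 * (HiggsLattice.Site.tdist x₁ x₂ : ℝ)) ^ α *
          (CH * (eR * pR) ^ (n + n') * (P.mesh k * (P.mesh k ^ P.d)⁻¹ * (P.mesh k ^ α)⁻¹)) *
          Real.exp (-(δ * (min (HiggsLattice.Site.tdist x₁ x' : ℝ) (HiggsLattice.Site.tdist x₂ x' : ℝ) / (P.L : ℝ) ^ k))))
    (hH' : ∀ (μ : Fin P.d) (x₁ x₂ x' : HiggsLattice.Site P 0) (Γ : List (HiggsLattice.Site P 0)), x₁ ≠ x₂ → IsAdm x₁ x₂ Γ →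
      (P.mesh 0 ^ P.d)⁻¹ * ∑ i' : Ix N, ‖hol C B x₁ Γ (covDeriv C B (op116 C Finset.univ A B msq a k n' n (cb P N 0 (x', i'))) ⟨x₂, μ⟩)
          - covDeriv C B (op116 C Finset.univ A B msq a k n' n (cb P N 0 (x', i'))) ⟨x₁, μ⟩‖
        ≤ (P.mesh 0 * (HiggsLattice.Site.tdist x₁ x₂ : ℝ)) ^ α *
          (CH * (eR * pR) ^ (n + n') * (P.mesh k * (P.mesh k ^ P.d)⁻¹ * (P.mesh k ^ α)⁻¹)) *
          Real.exp (-(δ * (min (HiggsLattice.Site.tdist x₁ x' : ℝ) (HiggsLattice.Site.tdist x₂ x' : ℝ) / (P.L : ℝ) ^ k))))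
    (hM : ∀ (μ ν : Fin P.d) (x x' : HiggsLattice.Site P 0),
      (P.mesh 0 ^ P.d)⁻¹ * ((P.mesh 0)⁻¹ *
          ∑ i : Ix N, ‖covDeriv C B (op116 C Finset.univ A B msq a k n n' (dip C B ⟨x', ν⟩ (onb N i))) ⟨x, μ⟩‖)
        ≤ CM * (eR * pR) ^ (n + n') * (P.mesh k ^ P.d)⁻¹ *
          Real.exp (-(δ * ((HiggsLattice.Site.tdist x x' : ℝ) / (P.L : ℝ) ^ k))))
    (hM' : ∀ (μ ν : Fin P.d) (x x' : HiggsLattice.Site P 0),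
      (P.mesh 0 ^ P.d)⁻¹ * ((P.mesh 0)⁻¹ *
          ∑ i : Ix N, ‖covDeriv C B (op116 C Finset.univ A B msq a k n' n (dip C B ⟨x', ν⟩ (onb N i))) ⟨x, μ⟩‖)
        ≤ CM * (eR * pR) ^ (n + n') * (P.mesh k ^ P.d)⁻¹ *
          Real.exp (-(δ * ((HiggsLattice.Site.tdist x x' : ℝ) / (P.L : ℝ) ^ k)))) :
    (sect2Smooth116 hL1 C Finset.univ Ω₂ A B msq a k K₀ r₀ m c₁ c₂ eR pR).Ineq25At n n' α (min δG δ)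
      (CG + (smoothConst P.d m c₁ (c₂ + 2 * c₁) * (CV + CD) + (CH + P.d * m * CM))) :=
  ineq25At_op116_smooth_of_bounds hL2 hk1 hkK (Finset.subset_univ Ω₂) n n' hα0 hα1 hc₁ hc₂ ht hCG hδ hCV hCD hCH hCM hδG
    (fun x x' _ _ => hV x x') (fun x x' _ _ => hV' x x') (fun μ x x' _ _ => hDv μ x x') (fun μ x x' _ _ => hDv' μ x x')
    (fun μ x₁ x₂ x' Γ _ _ _ hne hΓ => hH μ x₁ x₂ x' Γ hne hΓ) (fun μ x₁ x₂ x' Γ _ _ _ hne hΓ => hH' μ x₁ x₂ x' Γ hne hΓ)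
    (fun μ ν x x' _ _ => hM μ ν x x') (fun μ ν x x' _ _ => hM' μ ν x x')

/-- **Every single `Ineq25At` is implied**: a consumer that has the bound at `(δ₀, C)` has it at every weaker `(δ₀′ ≤ δ₀, C′ ≥ C)` with `C ≥ 0`
(rates and constants are monotone parameters of (2.5)). [cite: Balaban1983Higgs3, (2.5) p.424] -/
theorem ineq25At_smooth116_mono {n n' : ℕ} {α δ₀ δ₀' Cst Cst' : ℝ} (hδ : δ₀' ≤ δ₀) (hC : Cst ≤ Cst') (hC0 : 0 ≤ Cst) (ht : 0 ≤ eR * pR)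
    (h : (sect2Smooth116 hL1 C Ω Ω₂ A B msq a k K₀ r₀ m c₁ c₂ eR pR).Ineq25At n n' α δ₀ Cst) :
    (sect2Smooth116 hL1 C Ω Ω₂ A B msq a k K₀ r₀ m c₁ c₂ eR pR).Ineq25At n n' α δ₀' Cst' := by
  rw [ineq25At_smooth116_iff] at h ⊢
  have hC0' : 0 ≤ Cst' := hC0.trans hC
  refine ⟨fun f f' => (h.1 f f').trans ?_, fun f f' => (h.2 f f').trans ?_⟩
  · have hsd := setDist_nonneg k f.supp f'.supp
    exact mul_le_mul (mul_le_mul hC (exp_rate_mono hδ (Nat.cast_nonneg _)) (Real.exp_pos _).le hC0')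
      (exp_rate_mono hδ hsd) (Real.exp_pos _).le (by positivity)
  · have hsd := setDist_nonneg k f.supp f'.supp
    exact mul_le_mul (mul_le_mul_of_nonneg_right hC (pow_nonneg ht _)) (exp_rate_mono hδ hsd) (Real.exp_pos _).le (by positivity)

end Main

end Literature.MathematicalPhysics.QuantumFieldTheory.Balaban1983to89.B3Ineq25Op116Smooth

end
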